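import Literature.NumberTheory.Automorphic.Liu2021.AppendixC.HeckeTranslateSepQuotient
import Literature.AlgebraicGeometry.Motives.FiniteQuotientBaseChange
import HarnessLib

/-!
# From the level-quotient universal property to FINITE-GROUP QUOTIENTS: the level projections `u : X_N → X_K` and the normal-sub-level
# translates `T_{γ⁻¹} : X_{N″} → X_N` of a Shimura curve tower, over the reflex field and after complexification (Milne 2005 §5, Mumford §7)

Topic `NumberTheory/Automorphic/Liu2021/AppendixC`; namespace `Literature.NumberTheory.Automorphic.Liu2021.AppendixC`.
PROOF FILE (theorems only; no definition, no named fact, no instance, no `sorry`).  Generic over a §4.2 datum `C : Sec42Data` with Hecke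
translates `T : C.HeckeTranslates`; sequel of ★ `HeckeTranslateSepQuotient`.

INPUT: the LEVEL-QUOTIENT UNIVERSAL PROPERTY of the tower ([Milne2005ShimuraVarieties] §5 p. 57 «`Sh_K = Sh_{K′}/(K/K′)`», Rem. 5.29 (c);
[Deligne1979ShimuraVarieties] 2.7.1 (b)–(c)) in the shape the cell's curve towers deliver it (★ `levelQuotientUP_GS`,
★ `sec42DataOfFourLe_levelQuotientUP`): for `N ≤ K`, `N ⊴ K`, every `f : X_N → W` to a separated `W` invariant under the translates
`T_k` (`k ∈ K`) factors uniquely through `u : X_N → X_K`.  OUTPUT — the `act`∕`hp` inputs of ★ `Motives.exists_subgroup_isSepQuotient_pieceMap'`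
(pieces of a Galois cover of a non-connected curve):

* §1 `exists_act_isSepQuotient_map` — `u` is a quotient for separated test objects (`Motives.IsSepQuotient`) by the ACTION
  `k ↦ T_{k⁻¹} : ↥K →* Aut X_N` (a homomorphism by `T_g ≫ T_{g′} = T_{gg′}`; deck transformations by `T_{k⁻¹} ≫ u = u`);
* §2 `exists_finite_isSepQuotient_map` — the same through the FINITE group `K ∕ N` (`T_n = 𝟙` on `X_N` for `n ∈ N`; `K` compact, `N` open);
* §3 **`exists_finite_isSepQuotient_translate`** — for `N″ ⊴ K`, `γ⁻¹Nγ ⊆ K`, `γN″γ⁻¹ ⊆ N`: the translate `q′ = T_{γ⁻¹} : X_{N″} → X_N`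
  is a quotient by a finite group and `q′ ≫ T_γ = u″ : X_{N″} → X_K` (§2 at the conjugate level `γN″γ⁻¹ = heckeLevel γ N″ ≤ N`,
  ★ `C5.conj_mem_heckeLevel_of_normal`, ★ `exists_isSepQuotient_tr`, ★ `tr_inv_comp_tr_eq_map`);
* §4 `…_baseChange` — §2∕§3 after base change along any `τ : E →+* ℂ` (★ `Motives.isSepQuotient_baseChangeHom_of_isProjectiveOver`:
  `X_N` is projective, `Sec42Data.cpt.projective_X`), with the separatedness of the complexified target.

Cell `hodgecm-mathlib` (D-0151), crux `HLiu418` = stmt-HodgeConjecture-24832, d6 line, `stub_RosH` glue, (L3) ENTRY RECIPE: the three cover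
families `u`, `q′`, `u″` of every Hecke-word entry are Galois piecewise; this file is their tower-level Galois structure, the GS instance
(`A3Liu418GSTranslateQuotient`) is four one-line applications to ★ `levelQuotientUP_GS`.  COUNT-NEUTRAL capital: HC_CM is proved only modulo
the 7 printed citations until rung 0 closes.

## References
* [Milne2005ShimuraVarieties] J. S. Milne, *Introduction to Shimura varieties* (2005), §5 p. 57 L7–12, p. 58 L3–11, Rem. 5.29 (c) p. 65;
  §13 p. 118 L21–26.
* [Deligne1979ShimuraVarieties] P. Deligne, *Variétés de Shimura*, Proc. Symp. Pure Math. 33 (1979), 2.7.1 (b)–(c), 2.1.2.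
* [MumfordAV1970] D. Mumford, *Abelian Varieties* (1970), §7 Thm. p. 66 and Remark.
* [SGA1] A. Grothendieck, *SGA 1*, Exp. V §1 Prop. 1.1, 1.8.
-/

set_option autoImplicit false

noncomputable section

open CategoryTheory AlgebraicGeometry NumberField
open Literature.AlgebraicGeometry.Motives

namespace Literature.NumberTheory.Automorphic.Liu2021.AppendixC

universe u v

/-! ## §0 Generic: a quotient by `Γ` is a quotient by `Γ ∕ N` when `N` acts trivially -/

/-- If `p` is a quotient by `act : Γ →* Aut Y` for separated test objects and the normal subgroup `N` acts trivially, then `p` is a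
quotient by the induced action of `Γ ∕ N` (the universal property only sees the set of automorphisms `{act g}`).
[cite: MumfordAV1970, §7 Thm. p. 66 (Remark)] -/
theorem isSepQuotient_quotientLift {k : Type u} [Field k] {Y Z : SchemeOver k} {Γ : Type v} [Group Γ] (N : Subgroup Γ) [N.Normal]
    (act : Γ →* Aut Y) (hker : ∀ n ∈ N, act n = 1) {p : Y ⟶ Z} (h : IsSepQuotient (fun g => act g) p) :
    IsSepQuotient (fun g => QuotientGroup.lift N act hker g) p := by
  refine ⟨fun g => ?_, fun W f hW hf => h.2 W f hW fun k => ?_⟩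
  · obtain ⟨k, rfl⟩ := QuotientGroup.mk_surjective g
    exact h.1 k
  · exact hf (QuotientGroup.mk k)

section Sec42

variable {F E : Type} [Field F] [NumberField F] [IsTotallyReal F] [Field E] [NumberField E] [Algebra F E]
  [IsTotallyComplex E] [Algebra.IsQuadraticExtension F E]
variable {P5 : PropC5Data F E} {isotropicAt : ℕ → Prop}

namespace Sec42Data.HeckeTranslates

variable {C : Sec42Data P5 isotropicAt} (T : C.HeckeTranslates)

/-! ## §1 The level projection is the quotient by the translates `T_{k⁻¹}`, `k ∈ K` -/

/-- **`u^N_K : X_N → X_K` is a quotient of `X_N` by the translates `k ↦ T_{k⁻¹}` (`↥K →* Aut X_N`) for separated test objects**, granted the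
level-quotient universal property for `N ≤ K`, `N ⊴ K`: the action is a homomorphism (`T_g ≫ T_{g′} = T_{gg′}`, `T_1 = 𝟙`), its elements are
deck transformations (`T_{k⁻¹} ≫ u = T_{k⁻¹}^{N→K} = u ≫ T_{k⁻¹}^{K→K} = u`), and invariance under all `T_{k⁻¹}` is invariance under all `T_k`.
[cite: Milne2005ShimuraVarieties, §5 p. 57 L7–12, p. 58 L3–11 and Rem. 5.29 (c) p. 65] [cite: Deligne1979ShimuraVarieties, 2.7.1 (b)–(c)] -/
theorem exists_act_isSepQuotient_map ⦃N K : C5.SmallLevel C.S.K₀⦄ (hNK : N ≤ K) (hn : ∀ k ∈ K.1.1, C5.HeckeLE k N N)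
    (hUP : ∀ (W : SchemeOver E) (f : C.X N ⟶ W), IsSeparated W.hom →
      (∀ (k : C.G) (hk : k ∈ K.1.1), T.tr k N N (hn k hk) ≫ f = f) → ∃! fbar : C.X K ⟶ W, C.cpt.X.map (homOfLE hNK) ≫ fbar = f) :
    ∃ act : ↥K.1.1 →* Aut (C.X N),
      (∀ k : ↥K.1.1, (act k).hom = T.tr (k : C.G)⁻¹ N N (hn _ (K.1.1.inv_mem k.2))) ∧
      IsSepQuotient (fun k => act k) (C.cpt.X.map (homOfLE hNK)) := by
  have hinv : ∀ k : ↥K.1.1, T.tr (k : C.G)⁻¹ N N (hn _ (K.1.1.inv_mem k.2)) ≫ T.tr (k : C.G) N N (hn _ k.2) = 𝟙 _ :=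
    fun k => by
      rw [T.tr_mul, ← T.tr_self (K := N) (one_mem N.1.1)]
      exact T.tr_congr (inv_mul_cancel _) _ _
  have hinv' : ∀ k : ↥K.1.1, T.tr (k : C.G) N N (hn _ k.2) ≫ T.tr (k : C.G)⁻¹ N N (hn _ (K.1.1.inv_mem k.2)) = 𝟙 _ :=
    fun k => by
      rw [T.tr_mul, ← T.tr_self (K := N) (one_mem N.1.1)]
      exact T.tr_congr (mul_inv_cancel _) _ _
  let aut : ↥K.1.1 → Aut (C.X N) := fun k =>
    ⟨T.tr (k : C.G)⁻¹ N N (hn _ (K.1.1.inv_mem k.2)), T.tr (k : C.G) N N (hn _ k.2), hinv k, hinv' k⟩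
  have haut : ∀ k, (aut k).hom = T.tr (k : C.G)⁻¹ N N (hn _ (K.1.1.inv_mem k.2)) := fun _ => rfl
  have hmul : ∀ a b : ↥K.1.1, aut (a * b) = aut a * aut b := fun a b => by
    apply Iso.ext
    rw [Aut.Aut_mul_def, Iso.trans_hom, haut, haut, haut, T.tr_mul]
    exact T.tr_congr (by rw [Subgroup.coe_mul, mul_inv_rev]) _ _
  refine ⟨MonoidHom.mk' aut hmul, fun k => haut k, fun k => ?_, fun W f hW hf => ?_⟩
  · -- invariance: `T_{k⁻¹} ≫ u = u`
    change (aut k).hom ≫ _ = _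
    rw [haut, T.tr_comp_map, ← T.tr_one (homOfLE hNK)]
    have e : T.tr 1 N K (C5.HeckeLE.one_of_le (homOfLE hNK).le) ≫
        T.tr (k : C.G)⁻¹ K K (C5.HeckeLE.of_mem (K.1.1.inv_mem k.2)) = T.tr 1 N K (C5.HeckeLE.one_of_le (homOfLE hNK).le) := by
      rw [T.tr_self (K := K) (K.1.1.inv_mem k.2), Category.comp_id]
    rw [T.tr_mul] at e
    rw [← e]
    exact T.tr_congr (by rw [one_mul]) _ _
  · -- universal property (invariance under `T_k` from invariance under `T_{(k⁻¹)⁻¹}`)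
    refine hUP W f hW fun k hk => ?_
    have h1 := hf ⟨k⁻¹, K.1.1.inv_mem hk⟩
    change (aut _).hom ≫ f = f at h1
    rw [haut] at h1
    rw [← h1]
    congr 1
    exact T.tr_congr (by rw [Subgroup.coe_mk, inv_inv]) _ _

/-! ## §2 Through the finite group `K ∕ N` -/

/-- **`u^N_K` is a quotient of `X_N` by a FINITE group** (`K ∕ N`; the level `N` acts trivially, `T_n = 𝟙` for `n ∈ N`, `T.tr_self`; `K ∕ N` is
finite since `K` is compact and `N` open), granted the level-quotient universal property.
[cite: Milne2005ShimuraVarieties, §5 p. 57 L7–12 and Rem. 5.29 (c) p. 65] [cite: Deligne1979ShimuraVarieties, 2.7.1 (b)–(c)] -/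
theorem exists_finite_isSepQuotient_map ⦃N K : C5.SmallLevel C.S.K₀⦄ (hNK : N ≤ K) (hn : ∀ k ∈ K.1.1, C5.HeckeLE k N N)
    (hUP : ∀ (W : SchemeOver E) (f : C.X N ⟶ W), IsSeparated W.hom →
      (∀ (k : C.G) (hk : k ∈ K.1.1), T.tr k N N (hn k hk) ≫ f = f) → ∃! fbar : C.X K ⟶ W, C.cpt.X.map (homOfLE hNK) ≫ fbar = f) :
    ∃ (Δ : Type) (_ : Group Δ) (_ : Fintype Δ) (act : Δ →* Aut (C.X N)),
      IsSepQuotient (fun δ => act δ) (C.cpt.X.map (homOfLE hNK)) := by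
  classical
  obtain ⟨act, hact, hq⟩ := T.exists_act_isSepQuotient_map hNK hn hUP
  let Kg : Subgroup C.G := K.1.1
  let Ng : Subgroup ↥Kg := N.1.1.subgroupOf K.1.1
  have hmemNg : ∀ x : ↥Kg, x ∈ Ng ↔ (x : C.G) ∈ N.1.1 := fun x => Subgroup.mem_subgroupOf
  haveI hNn : Ng.Normal := ⟨fun n hn' g => by
    rw [hmemNg] at hn' ⊢
    have h1 := hn (g⁻¹ : ↥Kg) (g⁻¹).2 _ hn'
    simpa only [Subgroup.coe_inv, inv_inv, Subgroup.coe_mul] using h1⟩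
  haveI : CompactSpace ↥Kg := isCompact_iff_compactSpace.1 K.1.2.2
  have hNo : IsOpen (Ng : Set ↥Kg) := N.1.2.1.preimage continuous_subtype_val
  haveI : Finite (↥Kg ⧸ Ng) := Subgroup.quotient_finite_of_isOpen Ng hNo
  letI : Fintype (↥Kg ⧸ Ng) := Fintype.ofFinite _
  have hker : ∀ n ∈ Ng, act n = 1 := fun n hn' => by
    apply Iso.ext
    rw [hact]
    change _ = 𝟙 _
    exact T.tr_self (K := N) (N.1.1.inv_mem ((hmemNg n).1 hn'))
  exact ⟨↥Kg ⧸ Ng, inferInstance, inferInstance, QuotientGroup.lift Ng act hker, isSepQuotient_quotientLift Ng act hker hq⟩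

/-! ## §3 The translate `q′ = T_{γ⁻¹} : X_{N″} → X_N` from a normal sub-level -/

/-- **The translate `T_{γ⁻¹} : X_{N″} → X_N` is a quotient of `X_{N″}` by a FINITE group, and `T_{γ⁻¹} ≫ T_γ = u : X_{N″} → X_K`**, for
`N″ ⊴ K`, `N″ ≤ K`, `γ⁻¹Nγ ⊆ K` (`HeckeLE γ N K`), `γN″γ⁻¹ ⊆ N` (`HeckeLE γ⁻¹ N″ N`), granted the level-quotient universal property at ALL
normal level pairs (`hUP`): §2 at the conjugate level `γN″γ⁻¹ = heckeLevel γ N″ ≤ N` (normal in `N`, ★ `C5.conj_mem_heckeLevel_of_normal`)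
and ★ `exists_isSepQuotient_tr` (the level isomorphism `T_{γ⁻¹} : X_{N″} ⥲ X_{γN″γ⁻¹}`); the domination `q′ ≫ T_γ = u″` is
★ `tr_inv_comp_tr_eq_map`. [cite: Milne2005ShimuraVarieties, §5 p. 58 L3–11 and §13 p. 118 L21–26] [cite: MumfordAV1970, §7 Thm. p. 66 (Remark)] -/
theorem exists_finite_isSepQuotient_translate (γ : C.G) ⦃N'' N K : C5.SmallLevel C.S.K₀⦄
    (hn'' : ∀ k ∈ K.1.1, C5.HeckeLE k N'' N'') (hle : N'' ≤ K) (hγ : C5.HeckeLE γ N K) (h : C5.HeckeLE γ⁻¹ N'' N)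
    (hUP : ∀ ⦃N₁ K₁ : C5.SmallLevel C.S.K₀⦄ (h₁ : N₁ ≤ K₁) (hn₁ : ∀ k ∈ K₁.1.1, C5.HeckeLE k N₁ N₁)
      (W : SchemeOver E) (f : C.X N₁ ⟶ W), IsSeparated W.hom →
      (∀ (k : C.G) (hk : k ∈ K₁.1.1), T.tr k N₁ N₁ (hn₁ k hk) ≫ f = f) → ∃! fbar : C.X K₁ ⟶ W, C.cpt.X.map (homOfLE h₁) ≫ fbar = f) :
    ∃ (Δ : Type) (_ : Group Δ) (_ : Fintype Δ) (act : Δ →* Aut (C.X N'')),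
      IsSepQuotient (fun δ => act δ) (T.tr γ⁻¹ N'' N h) ∧ T.tr γ⁻¹ N'' N h ≫ T.tr γ N K hγ = C.cpt.X.map (homOfLE hle) := by
  have hle₃ : C5.heckeLevel γ N'' ≤ N := C5.heckeLevel_le_of_heckeLE_inv h
  have hn₃ : ∀ k ∈ N.1.1, C5.HeckeLE k (C5.heckeLevel γ N'') (C5.heckeLevel γ N'') :=
    C5.conj_mem_heckeLevel_of_normal hn'' hγ hle₃
  obtain ⟨Δ, instG, instF, act₃, hq₃⟩ := T.exists_finite_isSepQuotient_map hle₃ hn₃ (hUP hle₃ hn₃)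
  obtain ⟨act, hact⟩ := T.exists_isSepQuotient_tr γ h act₃ hq₃
  exact ⟨Δ, instG, instF, act, hact, T.tr_inv_comp_tr_eq_map γ h hγ hle⟩

/-! ## §4 After base change to `ℂ` -/

/-- **The complexified level projection `(u^N_K)_τ` is a quotient of `(X_N)_τ` by a finite group, and `(X_K)_τ` is separated** (§2 +
★ `isSepQuotient_baseChangeHom_of_isProjectiveOver`: `X_N` is projective), for any `τ : E →+* ℂ`. [cite: SGA1, Exp. V §1 Prop. 1.1, 1.8]
[cite: Milne2005ShimuraVarieties, Rem. 5.29 (c) p. 65] -/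
theorem exists_finite_isSepQuotient_map_baseChange (τ : E →+* ℂ) ⦃N K : C5.SmallLevel C.S.K₀⦄ (hNK : N ≤ K)
    (hn : ∀ k ∈ K.1.1, C5.HeckeLE k N N)
    (hUP : ∀ (W : SchemeOver E) (f : C.X N ⟶ W), IsSeparated W.hom →
      (∀ (k : C.G) (hk : k ∈ K.1.1), T.tr k N N (hn k hk) ≫ f = f) → ∃! fbar : C.X K ⟶ W, C.cpt.X.map (homOfLE hNK) ≫ fbar = f) :
    ∃ (Δ : Type) (_ : Group Δ) (_ : Fintype Δ) (act : Δ →* Aut (C.X N)),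
      IsSepQuotient (fun δ => act δ) (C.cpt.X.map (homOfLE hNK)) ∧
      IsSeparated ((baseChangeHom τ).obj (C.X K)).hom ∧
      IsSepQuotient (fun δ => (baseChangeHom τ).mapIso (act δ)) ((baseChangeHom τ).map (C.cpt.X.map (homOfLE hNK))) := by
  obtain ⟨Δ, instG, instF, act, hq⟩ := T.exists_finite_isSepQuotient_map hNK hn hUP
  obtain ⟨hsep, hqℂ⟩ := isSepQuotient_baseChangeHom_of_isProjectiveOver E τ Δ (C.X N) (C.X K) (C.cpt.projective_X N) act
    (C.cpt.X.map (homOfLE hNK)) (C.cpt.projective_X K).isSeparated hq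
  exact ⟨Δ, instG, instF, act, hq, hsep, hqℂ⟩

/-- **The complexified translate `(T_{γ⁻¹})_τ : (X_{N″})_τ → (X_N)_τ` is a quotient of `(X_{N″})_τ` by a finite group**, `(X_N)_τ` is
separated, and `(T_{γ⁻¹})_τ ≫ (T_γ)_τ = (u)_τ` (§3 base changed) — the `act`∕`hp` input of ★ `exists_subgroup_isSepQuotient_pieceMap'` at the
complex pieces for the `q′`-letters of the (L3) entry recipe. [cite: SGA1, Exp. V §1 Prop. 1.1, 1.8] [cite: Milne2005ShimuraVarieties, §13 p. 118 L21–26]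
[cite: MumfordAV1970, §7 Thm. p. 66 (Remark)] -/
theorem exists_finite_isSepQuotient_translate_baseChange (τ : E →+* ℂ) (γ : C.G) ⦃N'' N K : C5.SmallLevel C.S.K₀⦄
    (hn'' : ∀ k ∈ K.1.1, C5.HeckeLE k N'' N'') (hle : N'' ≤ K) (hγ : C5.HeckeLE γ N K) (h : C5.HeckeLE γ⁻¹ N'' N)
    (hUP : ∀ ⦃N₁ K₁ : C5.SmallLevel C.S.K₀⦄ (h₁ : N₁ ≤ K₁) (hn₁ : ∀ k ∈ K₁.1.1, C5.HeckeLE k N₁ N₁)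
      (W : SchemeOver E) (f : C.X N₁ ⟶ W), IsSeparated W.hom →
      (∀ (k : C.G) (hk : k ∈ K₁.1.1), T.tr k N₁ N₁ (hn₁ k hk) ≫ f = f) → ∃! fbar : C.X K₁ ⟶ W, C.cpt.X.map (homOfLE h₁) ≫ fbar = f) :
    ∃ (Δ : Type) (_ : Group Δ) (_ : Fintype Δ) (act : Δ →* Aut (C.X N'')),
      IsSepQuotient (fun δ => act δ) (T.tr γ⁻¹ N'' N h) ∧
      IsSeparated ((baseChangeHom τ).obj (C.X N)).hom ∧
      IsSepQuotient (fun δ => (baseChangeHom τ).mapIso (act δ)) ((baseChangeHom τ).map (T.tr γ⁻¹ N'' N h)) ∧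
      (baseChangeHom τ).map (T.tr γ⁻¹ N'' N h) ≫ (baseChangeHom τ).map (T.tr γ N K hγ) =
        (baseChangeHom τ).map (C.cpt.X.map (homOfLE hle)) := by
  obtain ⟨Δ, instG, instF, act, hq, hcomp⟩ := T.exists_finite_isSepQuotient_translate γ hn'' hle hγ h hUP
  obtain ⟨hsep, hqℂ⟩ := isSepQuotient_baseChangeHom_of_isProjectiveOver E τ Δ (C.X N'') (C.X N) (C.cpt.projective_X N'') act
    (T.tr γ⁻¹ N'' N h) (C.cpt.projective_X N).isSeparated hq
  have hcomp' : (baseChangeHom τ).map (T.tr γ⁻¹ N'' N h) ≫ (baseChangeHom τ).map (T.tr γ N K hγ) =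
      (baseChangeHom τ).map (C.cpt.X.map (homOfLE hle)) := by
    rw [← Functor.map_comp, hcomp]
  exact ⟨Δ, instG, instF, act, hq, hsep, hqℂ, hcomp'⟩

/-! ## §5 (ed. 2) The finite action consists of translates -/

/-- **Ed. 2: the finite quotient action CONSISTS OF TRANSLATES** (the `hact` binder of ★ (P3) `heckeEnd_eq_pushPull_of_aut` and of the
piecewise trace word): in `exists_finite_isSepQuotient_map` the finite group `Δ = K ∕ N` acts through the chosen translates — every `act δ`
is some `T_k` (`k ∈ K`; indeed `T_{k⁻¹}` for a representative `k` of `δ`), and every `T_k`, `k ∈ K`, occurs as some `act δ`.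
[cite: Milne2005ShimuraVarieties, §5 p. 57 L7–12, p. 58 L3–11 and Rem. 5.29 (c) p. 65] [cite: Deligne1979ShimuraVarieties, 2.7.1 (b)–(c)] -/
theorem exists_finite_isSepQuotient_map' ⦃N K : C5.SmallLevel C.S.K₀⦄ (hNK : N ≤ K) (hn : ∀ k ∈ K.1.1, C5.HeckeLE k N N)
    (hUP : ∀ (W : SchemeOver E) (f : C.X N ⟶ W), IsSeparated W.hom →
      (∀ (k : C.G) (hk : k ∈ K.1.1), T.tr k N N (hn k hk) ≫ f = f) → ∃! fbar : C.X K ⟶ W, C.cpt.X.map (homOfLE hNK) ≫ fbar = f) :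
    ∃ (Δ : Type) (_ : Group Δ) (_ : Fintype Δ) (act : Δ →* Aut (C.X N)),
      (∀ δ, ∃ (k : C.G) (hk : k ∈ K.1.1), (act δ).hom = T.tr k N N (hn k hk)) ∧
      (∀ (k : C.G) (hk : k ∈ K.1.1), ∃ δ, (act δ).hom = T.tr k N N (hn k hk)) ∧
      IsSepQuotient (fun δ => act δ) (C.cpt.X.map (homOfLE hNK)) := by
  classical
  obtain ⟨act, hact, hq⟩ := T.exists_act_isSepQuotient_map hNK hn hUP
  let Kg : Subgroup C.G := K.1.1
  let Ng : Subgroup ↥Kg := N.1.1.subgroupOf K.1.1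
  have hmemNg : ∀ x : ↥Kg, x ∈ Ng ↔ (x : C.G) ∈ N.1.1 := fun x => Subgroup.mem_subgroupOf
  haveI hNn : Ng.Normal := ⟨fun n hn' g => by
    rw [hmemNg] at hn' ⊢
    have h1 := hn (g⁻¹ : ↥Kg) (g⁻¹).2 _ hn'
    simpa only [Subgroup.coe_inv, inv_inv, Subgroup.coe_mul] using h1⟩
  haveI : CompactSpace ↥Kg := isCompact_iff_compactSpace.1 K.1.2.2
  have hNo : IsOpen (Ng : Set ↥Kg) := N.1.2.1.preimage continuous_subtype_val
  haveI : Finite (↥Kg ⧸ Ng) := Subgroup.quotient_finite_of_isOpen Ng hNo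
  letI : Fintype (↥Kg ⧸ Ng) := Fintype.ofFinite _
  have hker : ∀ n ∈ Ng, act n = 1 := fun n hn' => by
    apply Iso.ext
    rw [hact]
    change _ = 𝟙 _
    exact T.tr_self (K := N) (N.1.1.inv_mem ((hmemNg n).1 hn'))
  refine ⟨↥Kg ⧸ Ng, inferInstance, inferInstance, QuotientGroup.lift Ng act hker, fun δ => ?_, fun k hk => ?_,
    isSepQuotient_quotientLift Ng act hker hq⟩
  · obtain ⟨k, rfl⟩ := QuotientGroup.mk_surjective δ
    exact ⟨(k : C.G)⁻¹, K.1.1.inv_mem k.2, hact k⟩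
  · refine ⟨QuotientGroup.mk ⟨k⁻¹, K.1.1.inv_mem hk⟩, ?_⟩
    change (act _).hom = _
    rw [hact]
    exact T.tr_congr (by rw [Subgroup.coe_mk, inv_inv]) _ _

/-- **Ed. 2, complexified**: `exists_finite_isSepQuotient_map_baseChange` with the translate description of the action kept.
[cite: SGA1, Exp. V §1 Prop. 1.1, 1.8] [cite: Milne2005ShimuraVarieties, Rem. 5.29 (c) p. 65] -/
theorem exists_finite_isSepQuotient_map_baseChange' (τ : E →+* ℂ) ⦃N K : C5.SmallLevel C.S.K₀⦄ (hNK : N ≤ K)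
    (hn : ∀ k ∈ K.1.1, C5.HeckeLE k N N)
    (hUP : ∀ (W : SchemeOver E) (f : C.X N ⟶ W), IsSeparated W.hom →
      (∀ (k : C.G) (hk : k ∈ K.1.1), T.tr k N N (hn k hk) ≫ f = f) → ∃! fbar : C.X K ⟶ W, C.cpt.X.map (homOfLE hNK) ≫ fbar = f) :
    ∃ (Δ : Type) (_ : Group Δ) (_ : Fintype Δ) (act : Δ →* Aut (C.X N)),
      (∀ δ, ∃ (k : C.G) (hk : k ∈ K.1.1), (act δ).hom = T.tr k N N (hn k hk)) ∧
      (∀ (k : C.G) (hk : k ∈ K.1.1), ∃ δ, (act δ).hom = T.tr k N N (hn k hk)) ∧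
      IsSepQuotient (fun δ => act δ) (C.cpt.X.map (homOfLE hNK)) ∧
      IsSeparated ((baseChangeHom τ).obj (C.X K)).hom ∧
      IsSepQuotient (fun δ => (baseChangeHom τ).mapIso (act δ)) ((baseChangeHom τ).map (C.cpt.X.map (homOfLE hNK))) := by
  obtain ⟨Δ, instG, instF, act, h1, h2, hq⟩ := T.exists_finite_isSepQuotient_map' hNK hn hUP
  obtain ⟨hsep, hqℂ⟩ := isSepQuotient_baseChangeHom_of_isProjectiveOver E τ Δ (C.X N) (C.X K) (C.cpt.projective_X N) act
    (C.cpt.X.map (homOfLE hNK)) (C.cpt.projective_X K).isSeparated hq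
  exact ⟨Δ, instG, instF, act, h1, h2, hq, hsep, hqℂ⟩

end Sec42Data.HeckeTranslates

end Sec42

end Literature.NumberTheory.Automorphic.Liu2021.AppendixC

end
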